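import Summits.QuantumFields.BalabanUV.Beta.SymSliceProjectorSpread
import Summits.QuantumFields.BalabanUV.Beta.SymmetrisedDressingKernel

/-!
# `BalabanUV.Beta.SymSliceProjectorRules` — binder row D1, JSB12SYM-SPINE v1.1 (Σ3) step K1-b part 4: THE LEFT ACTION OF `symEc` and
# RULES 1–2 OF `RelInv` FOR THE SYMMETRISED CO-DRESSING: `symEc ∘ Π̂_sym = Π̂_sym,C`, `symEc ∘ (Π̂_sym K Π̂ᵀ_sym) = Π̂_sym K Π̂ᵀ_sym` and its transpose

CHART (RULING R-D1-g25-4): chart (II) — the FIXED κ = 0 slice at the CENTRED root `ctr`; hSX separate.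
HONEST FRAMING (cell contract, verbatim): «discharging `BetaPertH` makes Bałaban's UV stability UNCONDITIONAL — a real constructive-QFT
result; it is NOT the continuum limit and NOT the Clay problem.»  THIS MODULE DISCHARGES NOTHING of `BetaPertH` ∕ row D1: [folklore] kernel
bookkeeping of OUR objects (pattern `AxialCoordinateProjectorCoarse.comp_axEc_apply` + `AxialCoordinateProjectorCoarseRules.piKBmC` +
`AxialDressingRootedComposite.comp_axEc_coDressKBmAt`).  0 sorry, 0 `def … : Prop`, nothing cited.  NOT HERE (K2): rules 3–4 (the bordered Hessian
chain `bhK ∘ Π̂_sym K Π̂ᵀ_sym = Π̂_sym,C`), `permK`∕`refK` covariance of `symEc`.  NOT D1, NOT BetaPertH, NOT continuum, NOT Clay.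
HONEST DEPENDENCY (verbatim): «continuum YM on T⁴ ⇐ BetaPertH ∧ nine spine estimates (0/9 proved); BetaPertH ⇐ (D1) ∧ (D4) ∧ CAP+tail;
G-an2-4 gates asym, D1 and NE2/3/4.»  ABSOLUTE RULE (cell, verbatim): «No internally-minted statement may enter as a cited fact. Every
hypothesis is either kernel-proved in this package or a verbatim quotation of a PUBLISHED theorem with page reference.»
Unit `b2b-balaban-beta-an2` gen 25 (row-D1 owner), 2026-08-21.
-/

namespace Summit.QuantumFields.BalabanUV.Beta.SymSliceProjectorRules

noncomputable section

open Finset Matrix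
open scoped BigOperators Nat
open Literature.MathematicalPhysics.QuantumFieldTheory
open Literature.MathematicalPhysics.QuantumFieldTheory.Balaban1983to89
open Literature.MathematicalPhysics.QuantumFieldTheory.Balaban1983to89.Beta
open Literature.Probability.LatticeModels (Torus.proj)
open ExpKernelCalculus (MKer Decays comp)
open AffineAveraging (Form0 Form1 Site box toSite)
open AveragingContours (blk shift off off_mem_box blk_add_off blk_block)
open AveragingContoursRooted (ctr ctrOff ctrOff_mem_box)
open OneStepResolventKernel (Fib)
open Summit.QuantumFields.BalabanUV.Beta.TameKernelCalculus
open Summit.QuantumFields.BalabanUV.Beta.AxialDressingRooted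
open Summit.QuantumFields.BalabanUV.Beta.SymmetrisedAxialPotential (symAxial_add)
open Summit.QuantumFields.BalabanUV.Beta.SymmetrisedAxialGauge
open Summit.QuantumFields.BalabanUV.Beta.SymmetrisedAxialGaugeBlockMean
open Summit.QuantumFields.BalabanUV.Beta.SymmetrisedDressingMatrix
open Summit.QuantumFields.BalabanUV.Beta.SymmetrisedDressingKernel
open Summit.QuantumFields.BalabanUV.Beta.KernelOrthoProjector
open Summit.QuantumFields.BalabanUV.Beta.SymSliceBlockMatrix
open Summit.QuantumFields.BalabanUV.Beta.SymSliceProjectorKernel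
open Summit.QuantumFields.BalabanUV.Beta.SymSliceProjectorSpread

variable {d : ℕ}

/-! ## §1 Index bookkeeping -/

/-- [folklore] A sum over the interior-bond index type is the double sum over offsets and directions of the `dite`-extended summand. -/
theorem sum_bIdx_eq {N : ℕ} (F : BIdx (d + 1) N → ℝ) :
    ∑ j : BIdx (d + 1) N, F j
      = ∑ c ∈ box (d + 1) N, ∑ γ : Fin (d + 1), if h : (γ, c) ∈ bIdxSet (d + 1) N then F ⟨(γ, c), h⟩ else 0 := by
  classical
  set G : Fin (d + 1) × (Fin (d + 1) → ℕ) → ℝ := fun p => if h : p ∈ bIdxSet (d + 1) N then F ⟨p, h⟩ else 0 with hG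
  have h1 : ∑ j : BIdx (d + 1) N, F j = ∑ p ∈ bIdxSet (d + 1) N, G p := by
    rw [← Finset.sum_coe_sort (bIdxSet (d + 1) N) G]
    refine Fintype.sum_congr _ _ fun j => ?_
    simp only [hG, dif_pos j.2]
  have h2 : ∑ p ∈ bIdxSet (d + 1) N, G p = ∑ p ∈ (Finset.univ : Finset (Fin (d + 1))) ×ˢ box (d + 1) N, G p := by
    apply Finset.sum_subset
    · intro p hp
      exact Finset.mem_product.2 ⟨Finset.mem_univ _, (mem_bIdxSet.1 hp).1⟩
    · intro p _ hp
      simp only [hG, dif_neg hp]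
  rw [h1, h2, Finset.sum_product, Finset.sum_comm]

/-! ## §2 The left action of `symEc` -/

/-- [folklore] **MULTIPLIER ROWS**: `(symEc ∘ X)(x, m; ·) = [proj N x = 0] · X(x, m; ·)`. -/
theorem comp_symEc_apply_inr {N : ℕ} (X : MKer (d + 1) (Fib d)) (x x' : Fin (d + 1) → ℤ) (m : Fin (d + 1)) (b : Fib d) :
    comp (symEc N) X x x' (Sum.inr m) b = if Torus.proj N x = 0 then X x x' (Sum.inr m) b else 0 := by
  classical
  unfold ExpKernelCalculus.comp
  have h : ∀ y, ∑ f : Fib d, symEc N x y (Sum.inr m) f * X y x' f b =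
      if x = y then (if Torus.proj N x = 0 then X y x' (Sum.inr m) b else 0) else 0 := by
    intro y
    rw [Fintype.sum_sum_type]
    simp only [symEc_inr_inl, zero_mul, Finset.sum_const_zero, zero_add]
    rw [Finset.sum_eq_single m (fun m' _ hm' => by rw [symEc_inr_inr, if_neg (fun h => hm' h.2.1.symm), zero_mul])
      (fun h => absurd (Finset.mem_univ _) h), symEc_inr_inr]
    by_cases hy : x = y
    · by_cases hc : Torus.proj N x = 0
      · rw [if_pos ⟨hy, rfl, hc⟩, one_mul, if_pos hy, if_pos hc]
      · rw [if_neg (fun h => hc h.2.2), zero_mul, if_pos hy, if_neg hc]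
    · rw [if_neg (fun h => hy h.1), zero_mul, if_neg hy]
  simp_rw [h]
  rw [tsum_point]

/-- [folklore] **FACE-CROSSING FIELD ROWS**: for a NON-interior bond `(α, x)`, `(symEc ∘ X)(x, α; ·) = X(x, α; ·)`. -/
theorem comp_symEc_apply_inl_of_not_int {N : ℕ} (X : MKer (d + 1) (Fib d)) {x : Fin (d + 1) → ℤ} {α : Fin (d + 1)} (hα : ¬ IsIntBond N α x)
    (x' : Fin (d + 1) → ℤ) (b : Fib d) : comp (symEc N) X x x' (Sum.inl α) b = X x x' (Sum.inl α) b := by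
  classical
  unfold ExpKernelCalculus.comp
  have h : ∀ y, ∑ f : Fib d, symEc N x y (Sum.inl α) f * X y x' f b = if x = y then X y x' (Sum.inl α) b else 0 := by
    intro y
    rw [Fintype.sum_sum_type]
    simp only [symEc_inl_inr, zero_mul, Finset.sum_const_zero, add_zero]
    have hE : ∀ γ, symEc N x y (Sum.inl α) (Sum.inl γ) = if x = y ∧ α = γ then 1 else 0 := fun γ =>
      symEc_inl_inl_of_not_int (fun h => hα h.1)
    simp_rw [hE]
    rw [Finset.sum_eq_single α (fun γ _ hγ => by rw [if_neg (fun h => hγ h.2.symm), zero_mul]) (fun h => absurd (Finset.mem_univ _) h)]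
    by_cases hy : x = y
    · rw [if_pos ⟨hy, rfl⟩, one_mul, if_pos hy]
    · rw [if_neg (fun h => hy h.1), zero_mul, if_neg hy]
  simp_rw [h]
  rw [tsum_point]

/-- [folklore] **INTERIOR FIELD ROWS**: for an interior bond `(α, x)`, `(symEc ∘ X)(x, α; ·) = Σ_{j interior} Pmat (α, off x) j · X(N•blk x + j; ·)`
(the block-orthogonal projector acting on the column of `X` restricted to the block of `x`). -/
theorem comp_symEc_apply_inl_of_int {N : ℕ} (hN : 1 ≤ N) (X : MKer (d + 1) (Fib d)) {x : Fin (d + 1) → ℤ} {α : Fin (d + 1)}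
    (hα : IsIntBond N α x) (x' : Fin (d + 1) → ℤ) (b : Fib d) :
    comp (symEc N) X x x' (Sum.inl α) b
      = ∑ j : BIdx (d + 1) N, Pmat N ⟨(α, off N x), hα⟩ j * X ((N : ℤ) • blk N x + toSite j.1.2) x' (Sum.inl j.1.1) b := by
  classical
  unfold ExpKernelCalculus.comp
  -- the fibre sum at `y`
  have h : ∀ y, ∑ f : Fib d, symEc N x y (Sum.inl α) f * X y x' f b =
      if blk N x = blk N y then
        ∑ γ : Fin (d + 1), (if h : IsIntBond N γ y then Pmat N ⟨(α, off N x), hα⟩ ⟨(γ, off N y), h⟩ * X y x' (Sum.inl γ) b else 0)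
      else 0 := by
    intro y
    rw [Fintype.sum_sum_type]
    simp only [symEc_inl_inr, zero_mul, Finset.sum_const_zero, add_zero]
    by_cases hb : blk N x = blk N y
    · rw [if_pos hb]
      refine Finset.sum_congr rfl fun γ _ => ?_
      by_cases hγ : IsIntBond N γ y
      · rw [symEc_inl_inl_of_int hα hγ, if_pos hb, dif_pos hγ]
      · rw [symEc_inl_inl_of_not_int (fun h => hγ h.2), dif_neg hγ, if_neg, zero_mul]
        rintro ⟨rfl, rfl⟩
        exact hγ hα
    · rw [if_neg hb]
      refine Finset.sum_eq_zero fun γ _ => ?_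
      by_cases hγ : IsIntBond N γ y
      · rw [symEc_inl_inl_of_int hα hγ, if_neg hb, zero_mul]
      · rw [symEc_inl_inl_of_not_int (fun h => hγ h.2), if_neg, zero_mul]
        rintro ⟨rfl, rfl⟩
        exact hb rfl
  simp_rw [h]
  rw [tsum_block_of hN, sum_bIdx_eq]
  refine Finset.sum_congr rfl fun c hc => Finset.sum_congr rfl fun γ _ => ?_
  have hoff : off N ((N : ℤ) • blk N x + toSite c) = c := by
    -- (the offset of a block point; inlined — `D1BFx.CoProjBmDivergence.off_block` is the landed twin on the BF-x road)
    have h := blk_add_off hN ((N : ℤ) • blk N x + toSite c)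
    rw [blk_block (blk N x) hc] at h
    exact toSite_inj.1 (add_left_cancel h)
  by_cases hγ : (γ, c) ∈ bIdxSet (d + 1) N
  · have hγ' : IsIntBond N γ ((N : ℤ) • blk N x + toSite c) := by unfold IsIntBond; rw [hoff]; exact hγ
    rw [dif_pos hγ', dif_pos hγ]
    congr 2
    apply Subtype.ext
    simp only [hoff]
  · have hγ' : ¬ IsIntBond N γ ((N : ℤ) • blk N x + toSite c) := by unfold IsIntBond; rw [hoff]; exact hγ
    rw [dif_neg hγ', dif_neg hγ]

/-! ## §3 Gauge-fixed forms translate block by block -/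

/-- [folklore] Block translation preserves the symmetrised gauge condition. -/
theorem symAxialGaugeAt_shift_block {N : ℕ} (ρ : Site (d + 1)) {C : Form1 (d + 1) ℝ} (hC : SymAxialGaugeAt ρ C N) (B : Fin (d + 1) → ℤ) :
    SymAxialGaugeAt ρ (shift ((N : ℤ) • B) C) N := by
  intro y b hb
  rw [← symAxial_add]
  have e1 : (N : ℤ) • y + ρ + (N : ℤ) • B = (N : ℤ) • (y + B) + ρ := by rw [smul_add]; abel
  have e2 : (N : ℤ) • y + toSite b + (N : ℤ) • B = (N : ℤ) • (y + B) + toSite b := by rw [smul_add]; abel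
  rw [e1, e2]
  exact hC (y + B) b hb

/-- [folklore] **THE PROJECTOR ACTS AS THE IDENTITY ON THE BLOCK RESTRICTION OF A GAUGE-FIXED FORM, IN EVERY BLOCK**:
for an interior bond `(α, x)`, `Σ_j Pmat (α, off x) j · C(j.1, N•blk x + j.2) = C(α, x)`. -/
theorem sum_Pmat_mul_apply_of_symAxialGaugeAt {N : ℕ} (hN : 1 ≤ N) {C : Form1 (d + 1) ℝ} (hC : SymAxialGaugeAt (ctr (d + 1) N) C N)
    {x : Fin (d + 1) → ℤ} {α : Fin (d + 1)} (hα : IsIntBond N α x) :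
    ∑ j : BIdx (d + 1) N, Pmat N ⟨(α, off N x), hα⟩ j * C j.1.1 ((N : ℤ) • blk N x + toSite j.1.2) = C α x := by
  have hfix := Pmat_mulVec_restrictV hN (symAxialGaugeAt_shift_block (ctr (d + 1) N) hC (blk N x))
  have hrow := congrFun hfix ⟨(α, off N x), hα⟩
  rw [Matrix.mulVec, dotProduct] at hrow
  have hx : toSite (off N x) + (N : ℤ) • blk N x = x := (add_comm _ _).trans (blk_add_off hN x)
  simp only [restrictV, shift] at hrow
  rw [hx] at hrow
  rw [← hrow]
  refine Finset.sum_congr rfl fun j _ => ?_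
  rw [add_comm ((N : ℤ) • blk N x)]

/-! ## §4 Rule 1: `symEc ∘ Π̂_sym = Π̂_sym,C` and `symEc ∘ (Π̂_sym K Π̂ᵀ_sym) = Π̂_sym K Π̂ᵀ_sym` -/

/-- [our object] **THE SYMMETRISED PROJECTOR KERNEL WITH THE NON-COARSE MULTIPLIER ROWS KILLED** (cf. `piKBmC`). -/
def piKSymBmC (ρ : Fin (d + 1) → ℤ) (N : ℕ) : MKer (d + 1) (Fib d) :=
  fun x x' a b =>
    match a, b with
    | Sum.inl α, Sum.inl β => piKSymBm ρ N x x' (Sum.inl α) (Sum.inl β)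
    | Sum.inl _, Sum.inr _ => 0
    | Sum.inr _, Sum.inl _ => 0
    | Sum.inr m, Sum.inr m' => if x = x' ∧ m = m' ∧ Torus.proj N x = 0 then 1 else 0

/-- [folklore] Field block of `piKSymBmC` is that of `piKSymBm`. -/
theorem piKSymBmC_inl_inl (ρ : Fin (d + 1) → ℤ) (N : ℕ) (x x' : Fin (d + 1) → ℤ) (α β : Fin (d + 1)) :
    piKSymBmC ρ N x x' (Sum.inl α) (Sum.inl β) = piKSymBm ρ N x x' (Sum.inl α) (Sum.inl β) := rfl

/-- [folklore] Field–multiplier entry vanishes. -/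
theorem piKSymBmC_inl_inr (ρ : Fin (d + 1) → ℤ) (N : ℕ) (x x' : Fin (d + 1) → ℤ) (α m : Fin (d + 1)) :
    piKSymBmC ρ N x x' (Sum.inl α) (Sum.inr m) = 0 := rfl

/-- [folklore] Multiplier–field entry vanishes. -/
theorem piKSymBmC_inr_inl (ρ : Fin (d + 1) → ℤ) (N : ℕ) (x x' : Fin (d + 1) → ℤ) (m α : Fin (d + 1)) :
    piKSymBmC ρ N x x' (Sum.inr m) (Sum.inl α) = 0 := rfl

/-- [folklore] Multiplier block: the coarse indicator. -/
theorem piKSymBmC_inr_inr (ρ : Fin (d + 1) → ℤ) (N : ℕ) (x x' : Fin (d + 1) → ℤ) (m m' : Fin (d + 1)) :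
    piKSymBmC ρ N x x' (Sum.inr m) (Sum.inr m') = if x = x' ∧ m = m' ∧ Torus.proj N x = 0 then 1 else 0 := rfl

/-- [folklore] **RULE 1 AT PROJECTOR LEVEL**: `symEc ∘ Π̂_sym = Π̂_sym,C` (centred root, `N ≥ 1`): on interior rows the block-orthogonal projector
fixes the gauge-fixed columns of `Π^{sym}_bm` (K1b-1 (R12) translated to every block), on face-crossing rows `symEc` is the identity, on multiplier
rows it is the coarse indicator. -/
theorem comp_symEc_trK_piKSymBm {N : ℕ} (hN : 1 ≤ N) :
    comp (symEc N) (trK (piKSymBm (ctr (d + 1) N) N)) = trK (piKSymBmC (d := d) (ctr (d + 1) N) N) := by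
  have hr : ctrOff (d + 1) N ∈ box (d + 1) N := ctrOff_mem_box hN
  have hctr : ctr (d + 1) N = toSite (ctrOff (d + 1) N) := rfl
  funext x y a b
  rcases a with α | m
  · by_cases hα : IsIntBond N α x
    · rw [comp_symEc_apply_inl_of_int hN _ hα]
      rcases b with β | m
      · -- the gauge-fixed column `C := Π^{sym}_bm δ_{(β,y)}`
        have hcol : ∀ j : BIdx (d + 1) N, trK (piKSymBm (ctr (d + 1) N) N) ((N : ℤ) • blk N x + toSite j.1.2) y (Sum.inl j.1.1) (Sum.inl β)
            = symAxProjBmAt (ctr (d + 1) N) N (bondIndR β y) j.1.1 ((N : ℤ) • blk N x + toSite j.1.2) := fun j => by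
          show piKSymBm (ctr (d + 1) N) N y _ (Sum.inl β) (Sum.inl j.1.1) = _
          rw [hctr, piKSymBm_inl_inl_eq hN hr]; rfl
        simp_rw [hcol]
        rw [sum_Pmat_mul_apply_of_symAxialGaugeAt hN (by rw [hctr]; exact symAxialGaugeAt_symAxProjBmAt hN hr _) hα]
        show _ = piKSymBm (ctr (d + 1) N) N y x (Sum.inl β) (Sum.inl α)
        rw [hctr, piKSymBm_inl_inl_eq hN hr]; rfl
      · show _ = piKSymBmC (ctr (d + 1) N) N y x (Sum.inr m) (Sum.inl α)
        rw [piKSymBmC_inr_inl]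
        exact Finset.sum_eq_zero fun j _ => by
          rw [show trK (piKSymBm (ctr (d + 1) N) N) ((N : ℤ) • blk N x + toSite j.1.2) y (Sum.inl j.1.1) (Sum.inr m)
            = piKSymBm (ctr (d + 1) N) N y _ (Sum.inr m) (Sum.inl j.1.1) from rfl, piKSymBm_inr_inl, mul_zero]
    · rw [comp_symEc_apply_inl_of_not_int _ hα]
      rcases b with β | m
      · rfl
      · rfl
  · rw [comp_symEc_apply_inr]
    rcases b with β | m'
    · show (if Torus.proj N x = 0 then piKSymBm (ctr (d + 1) N) N y x (Sum.inl β) (Sum.inr m) else 0)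
          = piKSymBmC (ctr (d + 1) N) N y x (Sum.inl β) (Sum.inr m)
      rw [piKSymBm_inl_inr, piKSymBmC_inl_inr, ite_self]
    · show (if Torus.proj N x = 0 then piKSymBm (ctr (d + 1) N) N y x (Sum.inr m') (Sum.inr m) else 0)
          = piKSymBmC (ctr (d + 1) N) N y x (Sum.inr m') (Sum.inr m)
      rw [piKSymBm_inr_inr, piKSymBmC_inr_inr]
      by_cases hyx : y = x ∧ m' = m
      · obtain ⟨rfl, rfl⟩ := hyx
        by_cases hc : Torus.proj N y = 0
        · rw [if_pos hc, if_pos ⟨rfl, rfl⟩, if_pos ⟨rfl, rfl, hc⟩]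
        · rw [if_neg hc, if_neg (fun h => hc h.2.2)]
      · rw [if_neg hyx, ite_self, if_neg (fun h => hyx ⟨h.1, h.2.1⟩)]

/-- [folklore] `Π̂_sym,C K = Π̂_sym K` when the multiplier ROWS of `K` vanish off the coarse sites. -/
theorem comp_trK_piKSymBmC_eq (ρ : Fin (d + 1) → ℤ) {N : ℕ} {K : MKer (d + 1) (Fib d)}
    (hK : ∀ x, Torus.proj N x ≠ 0 → ∀ z m b, K x z (Sum.inr m) b = 0) :
    comp (trK (piKSymBmC ρ N)) K = comp (trK (piKSymBm ρ N)) K := by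
  funext x z a b
  unfold ExpKernelCalculus.comp
  refine tsum_congr fun y => Finset.sum_congr rfl fun f _ => ?_
  show piKSymBmC ρ N y x f a * K y z f b = piKSymBm ρ N y x f a * K y z f b
  rcases f with γ | m' <;> rcases a with α | m
  · rfl
  · rw [piKSymBmC_inl_inr, piKSymBm_inl_inr]
  · rw [piKSymBmC_inr_inl, piKSymBm_inr_inl]
  · rw [piKSymBmC_inr_inr, piKSymBm_inr_inr]
    by_cases hc : Torus.proj N y = 0
    · by_cases hyx : y = x ∧ m' = m
      · rw [if_pos ⟨hyx.1, hyx.2, hc⟩, if_pos hyx]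
      · rw [if_neg (fun h => hyx ⟨h.1, h.2.1⟩), if_neg hyx]
    · rw [hK y hc z m' b, mul_zero, mul_zero]

/-- [folklore] **RULE 1**: `symEc ∘ (Π̂_sym K Π̂ᵀ_sym) = Π̂_sym K Π̂ᵀ_sym` for a spread `K` whose multiplier rows vanish off the coarse sites
(centred root, `N ≥ 1`). -/
theorem comp_symEc_coDressKSymAt {N : ℕ} (hN : 1 ≤ N) {K : MKer (d + 1) (Fib d)} (sK : Spr K)
    (hK : ∀ x, Torus.proj N x ≠ 0 → ∀ z m b, K x z (Sum.inr m) b = 0) :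
    comp (symEc N) (coDressKSymAt (ctr (d + 1) N) N K) = coDressKSymAt (ctr (d + 1) N) N K := by
  have hr : ctrOff (d + 1) N ∈ box (d + 1) N := ctrOff_mem_box hN
  have hctr : ctr (d + 1) N = toSite (ctrOff (d + 1) N) := rfl
  have sE : Spr (symEc (d := d) N) := spr_symEc hN
  have sP : Spr (piKSymBm (d := d) (ctr (d + 1) N) N) := by rw [hctr]; exact spr_piKSymBm hN hr
  have sPt : Spr (trK (piKSymBm (d := d) (ctr (d + 1) N) N)) := sP.trK
  rw [coDressKSymAt_eq, comp_assoc_tame sE.tame (spr_comp sPt sK).tame sP.tame, comp_assoc_tame sE.tame sPt.tame sK.tame,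
    comp_symEc_trK_piKSymBm hN, comp_trK_piKSymBmC_eq _ hK]

/-- [folklore] Transpose of the co-dressing: `(Π̂ K Π̂ᵀ)ᵀ = Π̂ Kᵀ Π̂ᵀ`. -/
theorem trK_coDressKSymAt {N : ℕ} (hN : 1 ≤ N) {K : MKer (d + 1) (Fib d)} (sK : Spr K) :
    trK (coDressKSymAt (ctr (d + 1) N) N K) = coDressKSymAt (ctr (d + 1) N) N (trK K) := by
  have hr : ctrOff (d + 1) N ∈ box (d + 1) N := ctrOff_mem_box hN
  have hctr : ctr (d + 1) N = toSite (ctrOff (d + 1) N) := rfl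
  have sP : Spr (piKSymBm (d := d) (ctr (d + 1) N) N) := by rw [hctr]; exact spr_piKSymBm hN hr
  have sPt : Spr (trK (piKSymBm (d := d) (ctr (d + 1) N) N)) := sP.trK
  rw [coDressKSymAt_eq, coDressKSymAt_eq, trK_comp, trK_comp, trK_trK, comp_assoc_tame sPt.tame sK.trK.tame sP.tame]

/-- [folklore] **RULE 2**: `(Π̂_sym K Π̂ᵀ_sym) ∘ symEc = Π̂_sym K Π̂ᵀ_sym` for a spread `K` whose multiplier COLUMNS vanish off the coarse sites. -/
theorem comp_coDressKSymAt_symEc {N : ℕ} (hN : 1 ≤ N) {K : MKer (d + 1) (Fib d)} (sK : Spr K)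
    (hK : ∀ z, Torus.proj N z ≠ 0 → ∀ x a m, K x z a (Sum.inr m) = 0) :
    comp (coDressKSymAt (ctr (d + 1) N) N K) (symEc N) = coDressKSymAt (ctr (d + 1) N) N K := by
  have h1 : comp (symEc N) (coDressKSymAt (ctr (d + 1) N) N (trK K)) = coDressKSymAt (ctr (d + 1) N) N (trK K) :=
    comp_symEc_coDressKSymAt hN sK.trK (fun x hx z m b => hK x hx z b m)
  have h2 := congrArg trK h1
  rw [trK_comp, trK_symEc, trK_coDressKSymAt hN sK.trK, trK_trK] at h2
  exact h2

end

end Summit.QuantumFields.BalabanUV.Beta.SymSliceProjectorRules
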